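import Summits.QuantumFields.YangMills.Theorems.SwapVirialDeficitNearFlatLeaders
import Summits.QuantumFields.YangMills.Theorems.SwapVirialDeficitBlowUpGnomonicStratumBFlat
import HarnessLib

/-!
# NEAR-FLAT PROJECTION, CORNER FALLBACK: if NO leader is heavy (`‖im Ĉ_k‖ ≤ r` for all `k`) the configuration is within `O(r + σ-residual)` of a CENTRAL (flat) corner
# (free-hands support of ⟨stmt-QuantumFields-24197⟩ `SwapVirialDeficit.SwapGluedStiffness`; step (v-b) of the near-flat projection of LEAD g98's plan of record memo7 §C(c) —
# complements ✓`exists_flat_near_of_heavy`; choosing the threshold `r = F^{1/4}` between the two gives the Hölder-1/4 projection)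

* `flat_of_commuting_quadruple` — any unit, pairwise commuting quadruple with `C₁ = C₀`, pushed to `SU(2)` with followers `1`, has `chartDeficit = 0` (✓`chartDeficit_eq_zero_iff`);
* `norm_sub_signOne_le` — a unit quaternion is within `√2·‖im q‖` of the central element `±1` of the sign of its real part;
* ★★ `exists_flat_near_corner (q) (r) (hr : ∀ k, ‖im Ĉ_k‖ ≤ r)`: `∃ q♭` flat with followers `1`, `‖Ĉ_k − su2Quat(q♭.1 k)‖ ≤ √2·r` (`k ≠ 1`) and
  `‖Ĉ₁ − su2Quat(q♭.1 1)‖ ≤ ‖Ĉ₃Ĉ₁ − Ĉ₀Ĉ₃‖ + ‖[Ĉ₀, Ĉ₃]‖ + √2·r`.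

HONEST LABEL: elementary; stubs of ➎, ⟨24197⟩ ∕ ⟨24194⟩ ∕ ⟨24497⟩ OPEN; own crux ⟨22884⟩ OPEN (blocked-on ⟨19935⟩); the Yang–Mills mass gap is NOT proved; no summit is proved by a line.
THEOREMS ONLY (0 `def`, 0 `sorry`), standard axioms.  Width seat ym-line-sfw-p2-w3 g66 (cell ym-idea-1, free hands), `--supports stmt-QuantumFields-24197`.  References: [folklore].
-/

set_option autoImplicit false

noncomputable section

open Quaternion
open scoped Quaternion
open Literature.MathematicalPhysics.QuantumFieldTheory hiding SU2
open Literature.MathematicalPhysics.QuantumLattice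
open Literature.Analysis.Calculus (radialUnit radialUnit_def)
open Literature.MathematicalPhysics.QuantumFieldTheory.Balaban1983to89.T4WilsonGaugeFlatDirection (su2Quat_injective)

namespace Summit.QuantumFields.YangMills.Theorems.SwapVirialDeficit.NearFlat

open Summit.QuantumFields.YangMills.Theorems.FemtoTransferGap
open Summit.QuantumFields.YangMills.Theorems.FemtoTransferGap.TT
open Summit.QuantumFields.YangMills.Theorems.VirialFluxGap.RingDeficit
open Summit.QuantumFields.YangMills.Theorems.SwapVirialDeficit.SwapRing
open Summit.QuantumFields.YangMills.Theorems.SwapVirialDeficit.BlowUpRing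
open Summit.QuantumFields.YangMills.Theorems.SwapVirialDeficit.ZeroModeSigma (su2Quat_quatToSU2_eq_radialUnit)

variable {L : ℕ} [NeZero L]

/-- ★ A unit, pairwise commuting quadruple with `C₁ = C₀`, pushed to `SU(2)`, with all followers `1`, is FLAT. [folklore] -/
theorem flat_of_commuting_quadruple (Cf : Fin 4 → ℍ) (hfu : ∀ k, ‖Cf k‖ = 1) (hfc : ∀ k l, Cf k * Cf l = Cf l * Cf k) (hf10 : Cf 1 = Cf 0) :
    chartDeficit L (fun _ => false) (fun _ => 1) ((fun k => quatToSU2 (Cf k), fun _ => 1) : (Fin 4 → SU2) × (Fol L → SU2)) = 0 := by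
  have hne : ∀ k, Cf k ≠ 0 := fun k => by
    intro h0; have := hfu k; rw [h0, norm_zero] at this; exact zero_ne_one this
  have hsq : ∀ k, su2Quat (quatToSU2 (Cf k)) = Cf k := fun k => by
    rw [su2Quat_quatToSU2_eq_radialUnit (hne k), radialUnit_def, hfu k, inv_one, one_smul]
  have lift : ∀ {k l k' l' : Fin 4}, Cf k * Cf l = Cf k' * Cf l' →
      quatToSU2 (Cf k) * quatToSU2 (Cf l) = quatToSU2 (Cf k') * quatToSU2 (Cf l') := fun h =>
    su2Quat_injective (by rw [Balaban1983to89.T4HaarSU2Translate.su2Quat_mul, Balaban1983to89.T4HaarSU2Translate.su2Quat_mul, hsq, hsq, hsq, hsq]; exact h)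
  rw [chartDeficit_eq_zero_iff]
  refine ⟨fun μ ν => lift (hfc _ _), fun μ => ?_, fun i => rfl⟩
  fin_cases μ
  · show quatToSU2 (Cf (Fin.last 3)) * quatToSU2 (Cf (Fin.castSucc (Equiv.swap (0 : Fin 3) 1 0))) =
      quatToSU2 (Cf (Fin.castSucc 0)) * quatToSU2 (Cf (Fin.last 3))
    rw [Equiv.swap_apply_left]
    show quatToSU2 (Cf 3) * quatToSU2 (Cf 1) = quatToSU2 (Cf 0) * quatToSU2 (Cf 3)
    exact lift (by rw [hf10]; exact hfc 3 0)
  · show quatToSU2 (Cf (Fin.last 3)) * quatToSU2 (Cf (Fin.castSucc (Equiv.swap (0 : Fin 3) 1 1))) =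
      quatToSU2 (Cf (Fin.castSucc 1)) * quatToSU2 (Cf (Fin.last 3))
    rw [Equiv.swap_apply_right]
    show quatToSU2 (Cf 3) * quatToSU2 (Cf 0) = quatToSU2 (Cf 1) * quatToSU2 (Cf 3)
    exact lift (by rw [hf10]; exact hfc 3 0)
  · show quatToSU2 (Cf (Fin.last 3)) * quatToSU2 (Cf (Fin.castSucc (Equiv.swap (0 : Fin 3) 1 2))) =
      quatToSU2 (Cf (Fin.castSucc 2)) * quatToSU2 (Cf (Fin.last 3))
    rw [Equiv.swap_apply_of_ne_of_ne (by decide) (by decide)]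
    exact lift (hfc _ _)

/-- ★ A unit quaternion is within `√2·‖im q‖` of the central element `±1` matching the sign of its real part. [folklore] -/
theorem norm_sub_signOne_le {q : ℍ} (hq : ‖q‖ = 1) :
    ‖q - ((if 0 ≤ q.re then (1 : ℝ) else -1 : ℝ) : ℍ)‖ ≤ Real.sqrt 2 * ‖q.im‖ := by
  have hcomp : ‖q‖ ^ 2 = q.re ^ 2 + ‖q.im‖ ^ 2 := by
    rw [Literature.MathematicalPhysics.QuantumLattice.sq_norm_eq_sum_sq, Literature.MathematicalPhysics.QuantumLattice.sq_norm_eq_sum_sq q.im]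
    simp
    ring
  rw [hq, one_pow] at hcomp
  set s : ℝ := if 0 ≤ q.re then 1 else -1 with hs
  have hdist : ‖q - (s : ℍ)‖ ^ 2 = (q.re - s) ^ 2 + ‖q.im‖ ^ 2 := by
    rw [Literature.MathematicalPhysics.QuantumLattice.sq_norm_eq_sum_sq, Literature.MathematicalPhysics.QuantumLattice.sq_norm_eq_sum_sq q.im]
    simp
    ring
  have him0 : 0 ≤ ‖q.im‖ := norm_nonneg _
  have him1 : ‖q.im‖ ^ 2 ≤ 1 := by nlinarith [hcomp, sq_nonneg q.re]
  -- `(q.re − s)² ≤ ‖im q‖⁴ ≤ ‖im q‖²`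
  have hres : (q.re - s) ^ 2 ≤ ‖q.im‖ ^ 2 := by
    have hre2 : q.re ^ 2 = 1 - ‖q.im‖ ^ 2 := by linarith
    by_cases h0 : 0 ≤ q.re
    · have hs1 : s = 1 := by simp [hs, h0]
      rw [hs1]
      have hre1 : q.re ≤ 1 := by nlinarith
      -- (1 − re)² ≤ (1 − re)(1 + re) = ‖im‖² since 0 ≤ re ≤ 1
      nlinarith
    · have hs1 : s = -1 := by simp [hs, h0]
      rw [hs1]
      have h0' : q.re < 0 := lt_of_not_ge h0
      have hre1 : -1 ≤ q.re := by nlinarith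
      nlinarith
  have h2 : ‖q - (s : ℍ)‖ ^ 2 ≤ (Real.sqrt 2 * ‖q.im‖) ^ 2 := by
    rw [hdist, mul_pow, Real.sq_sqrt (by norm_num)]; linarith
  have hnn : 0 ≤ Real.sqrt 2 * ‖q.im‖ := by positivity
  exact (pow_le_pow_iff_left₀ (norm_nonneg _) hnn (by norm_num : (2 : ℕ) ≠ 0)).1 h2

/-- ★★ **CORNER FALLBACK**: if every leader has `‖im Ĉ_k‖ ≤ r`, the configuration is within `√2·r` (per leader, `k ≠ 1`) resp. `σ-residual + ‖[Ĉ₀, Ĉ₃]‖ + √2·r` (`k = 1`) of a FLAT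
central corner with followers `1`. [folklore] -/
theorem exists_flat_near_corner (q : (Fin 4 → SU2) × (Fol L → SU2)) (r : ℝ) (hr : ∀ k, ‖(su2Quat (q.1 k)).im‖ ≤ r) :
    ∃ qf : (Fin 4 → SU2) × (Fol L → SU2), chartDeficit L (fun _ => false) (fun _ => 1) qf = 0 ∧ (∀ i, qf.2 i = 1) ∧
      (∀ k, k ≠ 1 → ‖su2Quat (q.1 k) - su2Quat (qf.1 k)‖ ≤ Real.sqrt 2 * r) ∧
      ‖su2Quat (q.1 1) - su2Quat (qf.1 1)‖ ≤ ‖su2Quat (q.1 3) * su2Quat (q.1 1) - su2Quat (q.1 0) * su2Quat (q.1 3)‖ +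
        ‖su2Quat (q.1 0) * su2Quat (q.1 3) - su2Quat (q.1 3) * su2Quat (q.1 0)‖ + Real.sqrt 2 * r := by
  set C : Fin 4 → ℍ := fun k => su2Quat (q.1 k) with hC
  have hunit : ∀ k, ‖C k‖ = 1 := fun k => norm_su2Quat (q.1 k)
  -- the signs and the corner
  set sg : Fin 4 → ℝ := fun k => if 0 ≤ (C k).re then 1 else -1 with hsg
  set Cf : Fin 4 → ℍ := Function.update (fun k => ((sg k : ℝ) : ℍ)) 1 ((sg 0 : ℝ) : ℍ) with hCf
  have hCf_real : ∀ k, ∃ t : ℝ, Cf k = (t : ℍ) ∧ (t = 1 ∨ t = -1) := by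
    intro k
    by_cases hk : k = 1
    · subst hk; refine ⟨sg 0, by simp [hCf], ?_⟩; by_cases h0 : 0 ≤ (C 0).re <;> simp [hsg, h0]
    · refine ⟨sg k, by simp [hCf, hk], ?_⟩; by_cases h0 : 0 ≤ (C k).re <;> simp [hsg, h0]
  have hfu : ∀ k, ‖Cf k‖ = 1 := fun k => by
    obtain ⟨t, ht, h1⟩ := hCf_real k
    rw [ht, Quaternion.norm_coe]; rcases h1 with h1 | h1 <;> simp [h1]
  have hfc : ∀ k l, Cf k * Cf l = Cf l * Cf k := fun k l => by
    obtain ⟨t, ht, -⟩ := hCf_real k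
    rw [ht]; exact Quaternion.coe_commutes t (Cf l)
  have hf10 : Cf 1 = Cf 0 := by simp [hCf]
  have hsq : ∀ k, su2Quat (quatToSU2 (Cf k)) = Cf k := fun k => by
    have hne : Cf k ≠ 0 := by intro h0; have := hfu k; rw [h0, norm_zero] at this; exact zero_ne_one this
    rw [su2Quat_quatToSU2_eq_radialUnit hne, radialUnit_def, hfu k, inv_one, one_smul]
  refine ⟨(fun k => quatToSU2 (Cf k), fun _ => 1), flat_of_commuting_quadruple Cf hfu hfc hf10, fun _ => rfl, ?_, ?_⟩
  · intro k hk
    show ‖C k - su2Quat (quatToSU2 (Cf k))‖ ≤ _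
    rw [hsq k]
    have e : Cf k = ((sg k : ℝ) : ℍ) := by simp [hCf, hk]
    rw [e]
    exact (norm_sub_signOne_le (hunit k)).trans (mul_le_mul_of_nonneg_left (hr k) (Real.sqrt_nonneg _))
  · show ‖C 1 - su2Quat (quatToSU2 (Cf 1))‖ ≤ _
    rw [hsq 1, hf10]
    have e : Cf 0 = ((sg 0 : ℝ) : ℍ) := by simp [hCf]
    rw [e]
    calc ‖C 1 - ((sg 0 : ℝ) : ℍ)‖ = ‖(C 1 - C 0) + (C 0 - ((sg 0 : ℝ) : ℍ))‖ := by congr 1; abel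
      _ ≤ ‖C 1 - C 0‖ + ‖C 0 - ((sg 0 : ℝ) : ℍ)‖ := norm_add_le _ _
      _ ≤ (‖C 3 * C 1 - C 0 * C 3‖ + ‖C 0 * C 3 - C 3 * C 0‖) + Real.sqrt 2 * r :=
          add_le_add (norm_sub_le_rel_add_comm (hunit 3) (C 0) (C 1))
            ((norm_sub_signOne_le (hunit 0)).trans (mul_le_mul_of_nonneg_left (hr 0) (Real.sqrt_nonneg _)))

end Summit.QuantumFields.YangMills.Theorems.SwapVirialDeficit.NearFlat

end
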